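import Literature.AlgebraicGeometry.HodgeTheory.SymplecticTransvectionGroupDensity
import Literature.AlgebraicGeometry.HodgeTheory.AlgebraicMonodromyMumfordTate
import HarnessLib

/-!
# Transvection monodromy is Zariski dense in `Sp`: a subgroup of `GL(V)` with a non-trivial transvection
# along every vector of a spanning, orthogonally connected set has Zariski closure `Sp(V, B)`
# (Deligne, Weil II (4.4.1)–(4.4.2^α); the memo's "Lemma T" as printed, on `K`-points)

Family `hodge`, layer `Literature/AlgebraicGeometry/HodgeTheory`; sequel of
`SymplecticTransvectionGroupDensity.lean` (Part II there: the ABSTRACT group `M` generated by the full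
one-parameter transvection groups `U_r(K)`, `r ∈ R`, is `Sp(V, B)` when `R` spans `V` and is orthogonally
connected — `mem_oneParamTransvectionGroup_of_connected`; and the discharge of Deligne's Lemme (4.4.2^α))
and of `AlgebraicMonodromyMumfordTate.lean` (the tree's Zariski closures of subgroups of `GL(V)` on
`K`-points: `glZariskiClosure Δ`, via `Motives.zariskiClosureEnd` = "every `K`-polynomial in the matrix
entries vanishing on `Δ` vanishes at `g`", [CarlsonMullerStachPeters2017, Lemma–Definition 15.3.7]).
THEOREMS only; no definition, no named fact (net debt `0`).

## Why (the consumer)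

Deligne, Weil II, (4.4.1)–(4.4.2) (held text `paper:doi-10-1007-bf02684780` p0092 = p. 227): "Le groupe
`G` est un groupe algébrique semi-simple sur `Q_ℓ`. Pour que le sous-groupe compact `M` de `G` soit
ouvert, il suffit donc qu'il soit Zariski-dense. […] nous sommes ramenés à appliquer les lemmes
algébriques (4.4.2^α) […] à la clôture de Zariski de `M` dans `G(Q_ℓ)` et à la classe de conjugaison des
transformations de Picard-Lefschetz." A MONODROMY group `Γ` contains, along each vanishing cycle `r`,
ONE unipotent transvection `u_r = U_r(λ_r)` (`λ_r ≠ 0`), not the whole one-parameter group `U_r(K)`; the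
passage "Zariski closure of `⟨u_r⟩` ⊇ `U_r(K)`" (characteristic `0`) and "the Zariski closure of a group
is multiplicatively closed" is what turns Part II into the statement the route
`Summits/HodgeConjecture/HodgeConjecture/Theses/SignSymmetricPowers.lean` (crux K1,
`VeryGeneralSignCommutatorsInHg`; memo ROUTE-P3v11 §3.5 "Lemma T": "`Γ ⊂ Sp(W)` a subgroup containing a
non-trivial unipotent transvection `u_r` for every `r ∈ R`. Then the Zariski closure of `Γ` is `Sp(W)`")
consumes, in the vocabulary (`glZariskiClosure`) in which the tree's André–Deligne normality facts
(`andre1992_algebraicMonodromy_normal_mumfordTateGroup`, …) are typed.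

## What is here (all proved)

* §1 `mul_mem_zariskiClosureEndOfBasis` — the Zariski closure (in `End(V)`) of a multiplicatively closed
  set is multiplicatively closed (left/right multiplication = polynomial substitution `A·X·C`, as in the
  tree's `Motives.eval_bind₁_basisChange`); `one_add_smul_mem_zariskiClosureEndOfBasis` — if infinitely
  many points `1 + t n` of a line lie in `S`, the whole line lies in the closure (a one-variable polynomial
  with infinitely many roots is `0`).
* §2 `coe_oneParamTransvectionEquiv_pow` (`U_δ(c)^k = U_δ(kc)`), and the MAIN THEOREM
  **`mem_glZariskiClosure_of_isometry_of_transvections_mem`**: `char K = 0`, `V` finite-dimensional, `B`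
  alternating non-degenerate, `R` spanning and orthogonally connected, `Γ ≤ GL(V)` containing some
  `U_r(c)`, `c ≠ 0`, for every `r ∈ R` ⟹ every `B`-isometry lies in `glZariskiClosure Γ`.
* §3 the converse containment `isometry_of_mem_glZariskiClosure` (`Sp(V, B)` is Zariski closed: the
  isometry condition is the family of polynomial equations `ᵗ[g] G [g] = G`), and the EQUALITY
  **`mem_glZariskiClosure_iff_isometry`**: for `Γ ≤ Sp(V, B)` as above, `glZariskiClosure Γ` is exactly
  the set of `B`-isometries ("the Zariski closure of `Γ` is `Sp(W)`", on `K`-points).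

NOT here: identity components / finite-index subgroups (`glIdentityComponent`; for the K1 argument one
applies the theorem to a finite-index `Γ' ≤ Γ`, which still contains non-trivial powers `u_r^k`), the
geometric input (Picard–Lefschetz, Zariski, the B₂ confluence), positive characteristic.

## References

* [Deligne1980] P. Deligne, La conjecture de Weil : II, Publ. Math. IHÉS 52 (1980), §4.4, Thm (4.4.1),
  Lemme (4.4.2^α), (4.4.3^α)–(4.4.4^α), pp. 227–228 (held text PDF pp. 92–93).
* [CarlsonMullerStachPeters2017] J. Carlson, S. Müller-Stach, C. Peters, Period Mappings and Period
  Domains, 2nd ed. (2017), §15.3, Lemma–Definition 15.3.7 (`Γ^Zar`, the algebraic monodromy group).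
-/

noncomputable section

namespace Literature.AlgebraicGeometry.HodgeTheory

/-! ## §1 Zariski closures in `End(V)`: products and lines -/

section ZariskiMul

open Literature.AlgebraicGeometry.Motives

universe u v

variable {K : Type u} [Field K] {V : Type v} [AddCommGroup V] [Module K V]
variable {ι : Type*} [Fintype ι] [DecidableEq ι]

omit [DecidableEq ι] in
/-- **Two-sided multiplication is a polynomial substitution**: substituting the generic product
`A · X · C` (`X = (x_{kl})` the generic matrix) into `P` and evaluating at a matrix `X₀` is evaluating
`P` at `A X₀ C` (the tree's `eval_bind₁_basisChange`, for arbitrary `A`, `C`). [folklore] -/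
private theorem eval_bind₁_mul_mul (A C X₀ : Matrix ι ι K) (P : MvPolynomial (ι × ι) K) :
    MvPolynomial.eval (fun ij : ι × ι => X₀ ij.1 ij.2)
        (MvPolynomial.bind₁ (fun ij : ι × ι => ∑ l : ι, (∑ k : ι,
          MvPolynomial.C (A ij.1 k) * MvPolynomial.X (k, l)) * MvPolynomial.C (C l ij.2)) P) =
      MvPolynomial.eval (fun ij : ι × ι => (A * X₀ * C) ij.1 ij.2) P := by
  rw [MvPolynomial.eval, MvPolynomial.eval₂Hom_bind₁, ← MvPolynomial.eval, ← MvPolynomial.eval]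
  refine congrArg (fun c => MvPolynomial.eval c P) (funext fun ij => ?_)
  simp only [map_sum, map_mul, MvPolynomial.eval_C, MvPolynomial.eval_X, Matrix.mul_apply, Finset.sum_mul]

/-- **The Zariski closure of a multiplicatively closed set of endomorphisms is multiplicatively
closed** (left and right multiplication by a fixed endomorphism are polynomial maps of `End(V)`).
[cite: CarlsonMullerStachPeters2017, Lemma–Definition 15.3.7] -/
theorem mul_mem_zariskiClosureEndOfBasis (b : Module.Basis ι K V) {S : Set (Module.End K V)}
    (hS : ∀ g ∈ S, ∀ h ∈ S, g * h ∈ S) {g h : Module.End K V} (hg : g ∈ zariskiClosureEndOfBasis b S)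
    (hh : h ∈ zariskiClosureEndOfBasis b S) : g * h ∈ zariskiClosureEndOfBasis b S := by
  -- first `S · cl(S) ⊆ cl(S)`
  have left : ∀ s ∈ S, ∀ x ∈ zariskiClosureEndOfBasis b S, s * x ∈ zariskiClosureEndOfBasis b S := by
    intro s hs x hx P hP
    have key := hx (MvPolynomial.bind₁ (fun ij : ι × ι => ∑ l : ι, (∑ k : ι,
      MvPolynomial.C (LinearMap.toMatrix b b s ij.1 k) * MvPolynomial.X (k, l)) *
        MvPolynomial.C ((1 : Matrix ι ι K) l ij.2)) P) (fun y hy => by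
        rw [eval_bind₁_mul_mul, Matrix.mul_one, ← LinearMap.toMatrix_mul]
        exact hP _ (hS s hs y hy))
    rwa [eval_bind₁_mul_mul, Matrix.mul_one, ← LinearMap.toMatrix_mul] at key
  -- then `cl(S) · cl(S) ⊆ cl(S)` by right multiplication
  intro P hP
  have key := hg (MvPolynomial.bind₁ (fun ij : ι × ι => ∑ l : ι, (∑ k : ι,
    MvPolynomial.C ((1 : Matrix ι ι K) ij.1 k) * MvPolynomial.X (k, l)) *
      MvPolynomial.C (LinearMap.toMatrix b b h l ij.2)) P) (fun s hs => by
      rw [eval_bind₁_mul_mul, Matrix.one_mul, ← LinearMap.toMatrix_mul]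
      exact left s hs h hh P hP)
  rwa [eval_bind₁_mul_mul, Matrix.one_mul, ← LinearMap.toMatrix_mul] at key

/-- **A line through the closure**: if infinitely many points `1 + t n` of an affine line in `End(V)`
lie in `S`, the whole line lies in the Zariski closure of `S` (a polynomial in one variable with
infinitely many roots vanishes) — the algebraic-group fact "the Zariski closure of the group generated
by a unipotent `u = 1 + n ≠ 1` is the one-parameter group `{1 + t n}`" (char `0`) used in the form
needed here. [cite: CarlsonMullerStachPeters2017, Lemma–Definition 15.3.7] -/
theorem one_add_smul_mem_zariskiClosureEndOfBasis (b : Module.Basis ι K V) {S : Set (Module.End K V)}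
    (n : Module.End K V) (hS : {t : K | (1 : Module.End K V) + t • n ∈ S}.Infinite) (t : K) :
    (1 : Module.End K V) + t • n ∈ zariskiClosureEndOfBasis b S := by
  intro P hP
  set N := LinearMap.toMatrix b b n with hN
  let Q : Polynomial K := MvPolynomial.aeval
    (fun ij : ι × ι => Polynomial.C ((1 : Matrix ι ι K) ij.1 ij.2) + Polynomial.C (N ij.1 ij.2) * Polynomial.X) P
  have hQ : ∀ s : K, Q.eval s =
      MvPolynomial.eval (fun ij : ι × ι => LinearMap.toMatrix b b ((1 : Module.End K V) + s • n) ij.1 ij.2) P := by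
    intro s
    rw [map_add, map_smul, LinearMap.toMatrix_one, ← hN]
    change Polynomial.evalRingHom s (MvPolynomial.eval₂ Polynomial.C _ P) = _
    rw [MvPolynomial.eval₂_comp_left, MvPolynomial.eval]
    refine congrArg₂ (fun f c => MvPolynomial.eval₂ f c P) ?_ (funext fun ij => ?_)
    · ext a
      simp
    · simp only [Function.comp_apply, Polynomial.coe_evalRingHom, Polynomial.eval_add, Polynomial.eval_C,
        Polynomial.eval_mul, Polynomial.eval_X, Matrix.add_apply, Matrix.smul_apply, smul_eq_mul, mul_comm s]
  have hroots : {x : K | Q.IsRoot x}.Infinite := by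
    refine hS.mono fun s hs => ?_
    rw [Set.mem_setOf_eq, Polynomial.IsRoot.def, hQ]
    exact hP _ hs
  have hQ0 : Q = 0 := Polynomial.eq_zero_of_infinite_isRoot Q hroots
  rw [← hQ t, hQ0, Polynomial.eval_zero]

end ZariskiMul

/-! ## §2 Lemma T as printed: `Γ̄ ⊇ Sp(V, B)` -/

section ZariskiDense

open Literature.AlgebraicGeometry.Motives

universe u v

variable {K : Type u} [Field K] {V : Type v} [AddCommGroup V] [Module K V] [Module.Finite K V]
  {B : LinearMap.BilinForm K V}

omit [Module.Finite K V] in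
/-- Powers of a transvection unit: `(U_δ(c))^k = U_δ(k c)` for `⟨δ, δ⟩ = 0`.
[cite: Deligne1980, §4.4 Lemme (4.4.2^α) p. 227] -/
theorem coe_oneParamTransvectionEquiv_pow {δ : V} (hδ : B δ δ = 0) (c : K) (k : ℕ) :
    ((oneParamTransvectionEquiv B hδ c ^ k : V ≃ₗ[K] V) : Module.End K V) =
      oneParamTransvection B δ ((k : K) * c) := by
  induction k with
  | zero => rw [pow_zero, Nat.cast_zero, zero_mul, oneParamTransvection_zero]; rfl
  | succ k ih =>
    rw [pow_succ, LinearEquiv.coe_toLinearMap_mul, ih, coe_oneParamTransvectionEquiv, Module.End.mul_eq_comp,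
      oneParamTransvection_comp B hδ, Nat.cast_succ, add_mul, one_mul]

omit [Module.Finite K V] in
/-- `U_δ(t) = 1 + t • n_δ` with `n_δ = ⟨·, δ⟩ δ`. [cite: Deligne1980, §4.4 Lemme (4.4.2^α) p. 227] -/
theorem oneParamTransvection_eq_one_add_smul (δ : V) (t : K) :
    oneParamTransvection B δ t = (1 : Module.End K V) + t • (B.flip δ).smulRight δ := rfl

/-- **Memo Lemma T as printed (`K`-points): a subgroup `Γ ≤ GL(V)` containing a non-trivial unipotent
transvection along every vector of a spanning, orthogonally connected `R` has Zariski closure containing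
`Sp(V, B)`** — `K` of characteristic `0`, `V` finite-dimensional, `B` alternating non-degenerate. Proof:
the Zariski closure of `Γ` is multiplicatively closed (`mul_mem_zariskiClosureEndOfBasis`) and contains
each full one-parameter group `U_r(K)` (`one_add_smul_mem_zariskiClosureEndOfBasis`: the powers
`U_r(c)^k = U_r(kc)`, `k ∈ ℕ`, are infinitely many points of the line), hence contains Deligne's group
`M = ⟨U_r(c)⟩`, which is `Sp(V, B)` by `mem_oneParamTransvectionGroup_of_connected`.
[cite: Deligne1980, §4.4 Thm (4.4.1), Lemme (4.4.2^α) pp. 227–228] [cite: CarlsonMullerStachPeters2017, Lemma–Definition 15.3.7] -/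
theorem mem_glZariskiClosure_of_isometry_of_transvections_mem [CharZero K] (hB : B.IsAlt)
    (hBn : B.Nondegenerate) {R : Set V} (hR : Submodule.span K R = ⊤)
    (hconn : ∀ A ⊆ R, A.Nonempty → A ≠ R → ∃ r ∈ A, ∃ ρ ∈ R, ρ ∉ A ∧ B r ρ ≠ 0)
    {Γ : Subgroup (V ≃ₗ[K] V)} (hΓ : ∀ r (_ : r ∈ R), ∃ c : K, c ≠ 0 ∧ oneParamTransvectionEquiv B (hB r) c ∈ Γ)
    {g : V ≃ₗ[K] V} (hg : ∀ x y, B (g x) (g y) = B x y) : g ∈ glZariskiClosure Γ := by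
  classical
  haveI : Infinite K := Infinite.of_injective ((↑) : ℕ → K) Nat.cast_injective
  let b := Module.Free.chooseBasis K V
  set S : Set (Module.End K V) := (fun h : V ≃ₗ[K] V => (h : Module.End K V)) '' (Γ : Set (V ≃ₗ[K] V))
    with hSdef
  have hSmul : ∀ x ∈ S, ∀ y ∈ S, x * y ∈ S := by
    rintro _ ⟨x, hx, rfl⟩ _ ⟨y, hy, rfl⟩
    exact ⟨x * y, Γ.mul_mem hx hy, rfl⟩
  -- (1) each full one-parameter group `U_r(K)`, `r ∈ R`, lies in the closure
  have hU : ∀ r ∈ R, ∀ t : K, oneParamTransvection B r t ∈ zariskiClosureEndOfBasis b S := by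
    intro r hr t
    obtain ⟨c, hc, hmem⟩ := hΓ r hr
    rw [oneParamTransvection_eq_one_add_smul]
    refine one_add_smul_mem_zariskiClosureEndOfBasis b _ ?_ t
    have hinj : Function.Injective fun k : ℕ => (k : K) * c :=
      fun k l hkl => Nat.cast_injective (mul_right_cancel₀ hc hkl)
    refine (Set.infinite_range_of_injective hinj).mono ?_
    rintro _ ⟨k, rfl⟩
    refine ⟨oneParamTransvectionEquiv B (hB r) c ^ k, Γ.pow_mem hmem k, ?_⟩
    change ((oneParamTransvectionEquiv B (hB r) c ^ k : V ≃ₗ[K] V) : Module.End K V) = _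
    rw [coe_oneParamTransvectionEquiv_pow, oneParamTransvection_eq_one_add_smul]
  -- (2) the units whose map and inverse map lie in the closure form a subgroup containing `M`
  let T : Subgroup (V →ₗ[K] V)ˣ :=
    { carrier := {m | (m : Module.End K V) ∈ zariskiClosureEndOfBasis b S ∧
        ((m⁻¹ : (V →ₗ[K] V)ˣ) : Module.End K V) ∈ zariskiClosureEndOfBasis b S}
      mul_mem' := fun {x y} hx hy => ⟨by
          rw [Units.val_mul]; exact mul_mem_zariskiClosureEndOfBasis b hSmul hx.1 hy.1, by
          rw [_root_.mul_inv_rev, Units.val_mul]; exact mul_mem_zariskiClosureEndOfBasis b hSmul hy.2 hx.2⟩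
      one_mem' := by
        have h1 : (1 : Module.End K V) ∈ S := ⟨1, Γ.one_mem, rfl⟩
        exact ⟨subset_zariskiClosureEndOfBasis b S h1, by
          rw [inv_one]; exact subset_zariskiClosureEndOfBasis b S h1⟩
      inv_mem' := fun {x} hx => ⟨hx.2, by rw [inv_inv]; exact hx.1⟩ }
  have hMT : oneParamTransvectionGroup B R ≤ T := by
    refine (Subgroup.closure_le T).2 ?_
    rintro u ⟨δ, hδ, c, huc⟩
    refine ⟨?_, ?_⟩
    · rw [huc]; exact hU δ hδ c
    · rw [coe_inv_of_coe_eq_oneParamTransvection (hB δ) huc]; exact hU δ hδ (-c)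
  -- (3) `g` is in `M` by Lemma T
  have hgM : LinearMap.GeneralLinearGroup.ofLinearEquiv g ∈ oneParamTransvectionGroup B R :=
    mem_oneParamTransvectionGroup_of_connected hB hBn hR hconn (g := LinearMap.GeneralLinearGroup.ofLinearEquiv g) hg
  have h := (hMT hgM).1
  rw [mem_glZariskiClosure_iff, ← zariskiClosureEnd_basis_indep b]
  exact h

end ZariskiDense

/-! ## §3 `Sp(V, B)` is Zariski closed, and the equality `Γ̄ = Sp(V, B)` -/

section Closed

open Literature.AlgebraicGeometry.Motives

universe u v

variable {K : Type u} [Field K] {V : Type v} [AddCommGroup V] [Module K V] [Module.Finite K V]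
  {B : LinearMap.BilinForm K V}

/-- **`Sp(V, B)` is Zariski closed**: if every element of `Γ ≤ GL(V)` preserves `B`, so does every element
of `glZariskiClosure Γ` — the isometry condition is the system of polynomial equations
`(ᵗ[g] G [g])_{ij} = G_{ij}`, `G` the Gram matrix ("`M` un sous-groupe algébrique de `Sp(V)`").
[cite: Deligne1980, §4.4 (4.4.1)–(4.4.2^α) p. 227] [cite: CarlsonMullerStachPeters2017, Lemma–Definition 15.3.7] -/
theorem isometry_of_mem_glZariskiClosure {Γ : Subgroup (V ≃ₗ[K] V)}
    (hΓ : ∀ h ∈ Γ, ∀ x y, B (h x) (h y) = B x y) {g : V ≃ₗ[K] V} (hg : g ∈ glZariskiClosure Γ)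
    (x y : V) : B (g x) (g y) = B x y := by
  classical
  let b := Module.Free.chooseBasis K V
  set ι := Module.Free.ChooseBasisIndex K V
  set G : Matrix ι ι K := LinearMap.BilinForm.toMatrix b B with hG
  -- the polynomial `(ᵗX G X - G)_{ij}`
  let P : ι → ι → MvPolynomial (ι × ι) K := fun i j =>
    (∑ k : ι, ∑ l : ι, MvPolynomial.X (k, i) * MvPolynomial.C (G k l) * MvPolynomial.X (l, j)) - MvPolynomial.C (G i j)
  have hP : ∀ (f : Module.End K V) (i j : ι),
      MvPolynomial.eval (fun ij : ι × ι => LinearMap.toMatrix b b f ij.1 ij.2) (P i j) =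
        (LinearMap.BilinForm.toMatrix b (B.comp f f) - G) i j := by
    intro f i j
    rw [LinearMap.BilinForm.toMatrix_comp b b B, ← hG]
    simp only [P, map_sub, map_sum, map_mul, MvPolynomial.eval_X, MvPolynomial.eval_C, Matrix.sub_apply,
      Matrix.mul_apply, Matrix.transpose_apply, Finset.sum_mul]
    rw [Finset.sum_comm]
  have hvan : ∀ i j, ∀ f ∈ (fun h : V ≃ₗ[K] V => (h : Module.End K V)) '' (Γ : Set (V ≃ₗ[K] V)),
      MvPolynomial.eval (fun ij : ι × ι => LinearMap.toMatrix b b f ij.1 ij.2) (P i j) = 0 := by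
    rintro i j _ ⟨h, hh, rfl⟩
    rw [hP]
    have hc : B.comp (h : Module.End K V) (h : Module.End K V) = B :=
      LinearMap.BilinForm.ext fun x y => by rw [LinearMap.BilinForm.comp_apply]; exact hΓ h hh x y
    rw [hc, ← hG, sub_self, Matrix.zero_apply]
  have hg' := hg
  rw [mem_glZariskiClosure_iff, ← zariskiClosureEnd_basis_indep b] at hg'
  have hmat : LinearMap.BilinForm.toMatrix b (B.comp (g : Module.End K V) (g : Module.End K V)) = G := by
    ext i j
    have h := hg' (P i j) (hvan i j)
    rw [hP, Matrix.sub_apply, sub_eq_zero] at h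
    exact h
  have hcomp : B.comp (g : Module.End K V) (g : Module.End K V) = B :=
    (LinearMap.BilinForm.toMatrix b).injective (hmat.trans hG.symm)
  have h := LinearMap.congr_fun (LinearMap.congr_fun hcomp x) y
  rw [LinearMap.BilinForm.comp_apply] at h
  exact h

/-- **"The Zariski closure of `Γ` is `Sp(W)`" (memo Lemma T), on `K`-points**: for `K` of characteristic
`0`, `V` finite-dimensional, `B` alternating non-degenerate, `R` spanning and orthogonally connected, and
`Γ ≤ Sp(V, B)` containing a non-trivial transvection `U_r(c)`, `c ≠ 0`, along every `r ∈ R`: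
`g ∈ glZariskiClosure Γ ↔ g` preserves `B`.
[cite: Deligne1980, §4.4 Thm (4.4.1), Lemme (4.4.2^α) pp. 227–228] [cite: CarlsonMullerStachPeters2017, Lemma–Definition 15.3.7] -/
theorem mem_glZariskiClosure_iff_isometry [CharZero K] (hB : B.IsAlt) (hBn : B.Nondegenerate) {R : Set V}
    (hR : Submodule.span K R = ⊤)
    (hconn : ∀ A ⊆ R, A.Nonempty → A ≠ R → ∃ r ∈ A, ∃ ρ ∈ R, ρ ∉ A ∧ B r ρ ≠ 0)
    {Γ : Subgroup (V ≃ₗ[K] V)} (hΓsp : ∀ h ∈ Γ, ∀ x y, B (h x) (h y) = B x y)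
    (hΓ : ∀ r (_ : r ∈ R), ∃ c : K, c ≠ 0 ∧ oneParamTransvectionEquiv B (hB r) c ∈ Γ) (g : V ≃ₗ[K] V) :
    g ∈ glZariskiClosure Γ ↔ ∀ x y, B (g x) (g y) = B x y :=
  ⟨fun hg => isometry_of_mem_glZariskiClosure hΓsp hg, fun hg =>
    mem_glZariskiClosure_of_isometry_of_transvections_mem hB hBn hR hconn hΓ hg⟩

end Closed

end Literature.AlgebraicGeometry.HodgeTheory

end
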